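import Mathlib
import HarnessLib
import Summits.KontsevichZagierPeriods.Zeta5Search.HypergeometricWhipple

/-!
# TwoTaleWhippleBinomial — Zudilin's Remark 5 in binomial form, from Whipple's transformation (W)

HONEST FRAMING: systematic search; no irrationality claim unless certified.

fam-measure (pub-zeta5), FAMILY.md §10.11, successor task G1 (second third).  With Zudilin's Remark-5 data
`a = (a₁, a₂, a₃, a₄)`, `b = (1, a₄−a₁+1, a₄−a₂+1, b₄)` in the regime `a₁, a₂, a₃ ≤ a₄` write
`x = a₄−a₁`, `y = a₄−a₂`, `z = a₄−a₃`, `e = a₁+a₂−a₄−1`, `e' = a₂+a₃−a₄−1`, `N = b₄−a₄−1` (naturals, with the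
one relation `x + e = z + e'`, both being `a₂ − 1`).  The first-tale coefficient `q(a, b) = formQZ a b` and the
second-tale coefficient `q̂ = formQTZ (â, b̂)` of the Whipple partner are then (successor task, (E1)/(E2) of the
blueprint) `(−1)^{N+1} ∑_n T_n` and `∑_r U_r` with

  `T_n = (−1)^n C(N,n) C(n+x+y+e, y+e) C(n+y+e, e) C(n+x+e, e')`,
  `U_r = C(x+y+e+2r, N+z) C(r+y+e', e') C(x+e, x+r) C(N, r)`,

and Remark 5 (`q = −q̂`) is the **binomial identity** `∑_{r≤N} U_r = (−1)^N ∑_{n≤N} T_n` (`binomialWhipple`),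
which this file PROVES from `HypergeometricWhipple.whipple_nearlyPoised_terms` at `f = x+y+e+1`, `h = x+1`,
`a = −e`, `g = z+1` via the termwise dictionary
`T_n · (x+1)_N (y+1)_N (z+1)_N = K · nearlyPoisedTerm … n` (`dictT`),
`U_r · (x+1)_N (y+1)_N (z+1)_N · (−1)^N = K · saalschutzianTerm … r` (`dictU`),
`K = C(x+y+e, y+e) C(y+e, e) C(x+e, e')`, and cancellation of the positive integer `(x+1)_N (y+1)_N (z+1)_N`.
Elementary inputs: `choose_mul_rf` (`C(n+c,m) (c+1−m)_n = C(c,m) (c+1)_n`), `choose_mul_rf_neg`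
(`C(x+e,x+r) (x+1)_r = C(x+e,e) (−1)^r (−e)_r`), `f4base` (a factorial-clearing identity) and `f4` (its
continuation in `N` by the common term ratio `−(y+e'+2r−N)`).  Checked numerically beforehand
(`dict_termwise.py`, 29 700 instances).
-/

namespace Summit.KontsevichZagierPeriods.Zeta5Search.TwoTaleWhippleBinomial

open Finset
open Summit.KontsevichZagierPeriods.Zeta5Search.HypergeometricWhipple

/-! ### Rising factorials at integer points -/

/-- `(k+1)_m` over `ℤ` is the ascending factorial. -/
theorem rf_natCast_succ (k m : ℕ) : rf ((k : ℤ) + 1) m = (((k + 1).ascFactorial m : ℕ) : ℤ) := by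
  induction m with
  | zero => simp [rf_zero]
  | succ m ih =>
    rw [rf_succ, ih, Nat.ascFactorial_succ]
    push_cast; ring

/-- `(k+1)_m > 0` over `ℤ`. -/
theorem rf_natCast_succ_pos (k m : ℕ) : 0 < rf ((k : ℤ) + 1) m := by
  rw [rf_natCast_succ]
  exact_mod_cast Nat.ascFactorial_pos _ _

/-- `(−e)_m = 0` for naturals `e < m`. -/
theorem rf_neg_natCast_eq_zero {e m : ℕ} (h : e < m) : rf (-(e : ℤ)) m = 0 := by
  unfold rf
  exact Finset.prod_eq_zero (mem_range.2 h) (by simp)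

/-- `C(n+c, m) (c+1−m)_n = C(c, m) (c+1)_n` for `m ≤ c`. -/
theorem choose_mul_rf (c m n : ℕ) (hm : m ≤ c) :
    (((n + c).choose m : ℕ) : ℤ) * rf ((c : ℤ) + 1 - m) n = ((c.choose m : ℕ) : ℤ) * rf ((c : ℤ) + 1) n := by
  induction n with
  | zero => simp [rf_zero]
  | succ n ih =>
    have hr : (((n + 1 + c).choose m : ℕ) : ℤ) * ((n : ℤ) + c + 1 - m) =
        (((n + c).choose m : ℕ) : ℤ) * ((n : ℤ) + c + 1) := by
      have h := Nat.choose_mul_succ_eq (n + c) m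
      have h' := congrArg (Nat.cast (R := ℤ)) h
      push_cast [Nat.cast_sub (show m ≤ n + c + 1 by omega)] at h'
      rw [show n + 1 + c = n + c + 1 by ring]
      linear_combination (-1 : ℤ) * h'
    rw [rf_succ, rf_succ]
    linear_combination (rf ((c : ℤ) + 1 - m) n) * hr + ((n : ℤ) + c + 1) * ih

/-- `C(x+e, x+r) (x+1)_r = C(x+e, e) (−1)^r (−e)_r`. -/
theorem choose_mul_rf_neg (x e r : ℕ) :
    (((x + e).choose (x + r) : ℕ) : ℤ) * rf ((x : ℤ) + 1) r =
      (((x + e).choose e : ℕ) : ℤ) * ((-1) ^ r * rf (-(e : ℤ)) r) := by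
  induction r with
  | zero => simpa [rf_zero] using (Nat.choose_symm_add (a := x) (b := e))
  | succ r ih =>
    rcases Nat.lt_or_ge e (r + 1) with hlt | hge
    · rw [Nat.choose_eq_zero_of_lt (by omega), rf_neg_natCast_eq_zero hlt]
      simp
    · have hr : (((x + e).choose (x + r + 1) : ℕ) : ℤ) * ((x : ℤ) + r + 1) =
          (((x + e).choose (x + r) : ℕ) : ℤ) * ((e : ℤ) - r) := by
        have h := Nat.choose_succ_right_eq (x + e) (x + r)
        have h' := congrArg (Nat.cast (R := ℤ)) h
        push_cast [Nat.cast_sub (show x + r ≤ x + e by omega)] at h'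
        linear_combination h'
      rw [show x + (r + 1) = x + r + 1 by ring, rf_succ, rf_succ, pow_succ]
      linear_combination (rf ((x : ℤ) + 1) r) * hr + ((e : ℤ) - r) * ih

/-! ### The nearly-poised (first-tale) side -/

/-- **Termwise dictionary, first tale**: `T_n · (x+1)_N (y+1)_N (z+1)_N = K · nearlyPoisedTerm (x+y+e+1) (x+1)
(−e) (z+1) N n`. -/
theorem dictT (x y z e e' N n : ℕ) (hz : x + e = z + e') (hn : n ≤ N) :
    ((-1 : ℤ) ^ n * ((N.choose n : ℕ) : ℤ) * (((n + (x + y + e)).choose (y + e) : ℕ) : ℤ) *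
        (((n + (y + e)).choose e : ℕ) : ℤ) * (((n + (x + e)).choose e' : ℕ) : ℤ)) *
      (rf ((x : ℤ) + 1) N * rf ((y : ℤ) + 1) N * rf ((z : ℤ) + 1) N) =
    ((((x + y + e).choose (y + e) : ℕ) : ℤ) * (((y + e).choose e : ℕ) : ℤ) * (((x + e).choose e' : ℕ) : ℤ)) *
      nearlyPoisedTerm ((x : ℤ) + y + e + 1) ((x : ℤ) + 1) (-(e : ℤ)) ((z : ℤ) + 1) N n := by
  have h1 := choose_mul_rf (x + y + e) (y + e) n (by omega)
  have h2 := choose_mul_rf (y + e) e n (by omega)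
  have h3 := choose_mul_rf (x + e) e' n (by omega)
  have hz' : ((x : ℤ) + e) = z + e' := by exact_mod_cast hz
  rw [show ((x + y + e : ℕ) : ℤ) + 1 - ((y + e : ℕ) : ℤ) = (x : ℤ) + 1 by push_cast; ring,
    show ((x + y + e : ℕ) : ℤ) + 1 = (x : ℤ) + y + e + 1 by push_cast; ring] at h1
  rw [show ((y + e : ℕ) : ℤ) + 1 - ((e : ℕ) : ℤ) = (y : ℤ) + 1 by push_cast; ring,
    show ((y + e : ℕ) : ℤ) + 1 = (y : ℤ) + e + 1 by push_cast; ring] at h2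
  rw [show ((x + e : ℕ) : ℤ) + 1 - ((e' : ℕ) : ℤ) = (z : ℤ) + 1 by push_cast; linarith,
    show ((x + e : ℕ) : ℤ) + 1 = (x : ℤ) + e + 1 by push_cast; ring] at h3
  -- tails
  have t1 : rf ((x : ℤ) + 1) N = rf ((x : ℤ) + 1) n * rf ((x : ℤ) + 1 + n) (N - n) := by
    rw [← rf_add, Nat.add_sub_cancel' hn]
  have t2 : rf ((y : ℤ) + 1) N = rf ((y : ℤ) + 1) n * rf ((y : ℤ) + 1 + n) (N - n) := by
    rw [← rf_add, Nat.add_sub_cancel' hn]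
  have t3 : rf ((z : ℤ) + 1) N = rf ((z : ℤ) + 1) n * rf ((z : ℤ) + 1 + n) (N - n) := by
    rw [← rf_add, Nat.add_sub_cancel' hn]
  unfold nearlyPoisedTerm
  rw [show (1 + ((x : ℤ) + y + e + 1) - ((x : ℤ) + 1)) = (y : ℤ) + e + 1 by ring,
    show ((x : ℤ) + 1 - -(e : ℤ)) = (x : ℤ) + e + 1 by ring,
    show (1 + ((x : ℤ) + y + e + 1) + -(e : ℤ) - ((x : ℤ) + 1) + n) = (y : ℤ) + 1 + n by ring,
    t1, t2, t3]
  linear_combination ((-1 : ℤ) ^ n * ((N.choose n : ℕ) : ℤ) * rf ((x : ℤ) + 1 + n) (N - n) *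
      rf ((y : ℤ) + 1 + n) (N - n) * rf ((z : ℤ) + 1 + n) (N - n)) *
    (((((n + (y + e)).choose e : ℕ) : ℤ) * rf ((y : ℤ) + 1) n) *
        ((((n + (x + e)).choose e' : ℕ) : ℤ) * rf ((z : ℤ) + 1) n) * h1 +
      ((((x + y + e).choose (y + e) : ℕ) : ℤ) * rf ((x : ℤ) + y + e + 1) n) *
        ((((n + (x + e)).choose e' : ℕ) : ℤ) * rf ((z : ℤ) + 1) n) * h2 +
      ((((x + y + e).choose (y + e) : ℕ) : ℤ) * rf ((x : ℤ) + y + e + 1) n) *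
        ((((y + e).choose e : ℕ) : ℤ) * rf ((y : ℤ) + e + 1) n) * h3)

/-! ### The Saalschützian (second-tale) side -/

/-- Factorial clearing (ℕ): `C(x+e,e) C(y+e',e') (y+e'+1)_r C(x+y+e+2r, r+z) (z+1)_r
= C(x+y+e,y+e) C(y+e,e) C(x+e,e') (x+y+e+1)_{2r}` when `x + e = z + e'` (both sides times
`x! e! y! e'! z!` equal `(x+e)! (x+y+e+2r)!`). -/
theorem f4base (x y z e e' r : ℕ) (hz : x + e = z + e') :
    (x + e).choose e * (y + e').choose e' * (y + e' + 1).ascFactorial r * (x + y + e + 2 * r).choose (r + z) *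
        (z + 1).ascFactorial r =
      (x + y + e).choose (y + e) * (y + e).choose e * (x + e).choose e' * (x + y + e + 1).ascFactorial (2 * r) := by
  have D : 0 < Nat.factorial x * Nat.factorial e * Nat.factorial y * Nat.factorial e' * Nat.factorial z := by
    positivity
  apply Nat.eq_of_mul_eq_mul_right D
  have c1 : (x + e).choose e * Nat.factorial e * Nat.factorial x = Nat.factorial (x + e) := by
    have := Nat.choose_mul_factorial_mul_factorial (show e ≤ x + e by omega)
    rwa [show x + e - e = x by omega] at this
  have c2 : (y + e').choose e' * Nat.factorial e' * Nat.factorial y = Nat.factorial (y + e') := by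
    have := Nat.choose_mul_factorial_mul_factorial (show e' ≤ y + e' by omega)
    rwa [show y + e' - e' = y by omega] at this
  have c3 : Nat.factorial (y + e') * (y + e' + 1).ascFactorial r = Nat.factorial (y + e' + r) :=
    Nat.factorial_mul_ascFactorial _ _
  have c4 : (x + y + e + 2 * r).choose (r + z) * Nat.factorial (r + z) * Nat.factorial (y + e' + r) =
      Nat.factorial (x + y + e + 2 * r) := by
    have := Nat.choose_mul_factorial_mul_factorial (show r + z ≤ x + y + e + 2 * r by omega)
    rwa [show x + y + e + 2 * r - (r + z) = y + e' + r by omega] at this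
  have c5 : Nat.factorial z * (z + 1).ascFactorial r = Nat.factorial (z + r) := Nat.factorial_mul_ascFactorial _ _
  have c6 : (y + e).choose e * Nat.factorial e * Nat.factorial y = Nat.factorial (y + e) := by
    have := Nat.choose_mul_factorial_mul_factorial (show e ≤ y + e by omega)
    rwa [show y + e - e = y by omega] at this
  have c7 : (x + y + e).choose (y + e) * Nat.factorial (y + e) * Nat.factorial x = Nat.factorial (x + y + e) := by
    have := Nat.choose_mul_factorial_mul_factorial (show y + e ≤ x + y + e by omega)
    rwa [show x + y + e - (y + e) = x by omega] at this
  have c8 : (x + e).choose e' * Nat.factorial e' * Nat.factorial z = Nat.factorial (x + e) := by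
    have := Nat.choose_mul_factorial_mul_factorial (show e' ≤ x + e by omega)
    rwa [show x + e - e' = z by omega] at this
  have c9 : Nat.factorial (x + y + e) * (x + y + e + 1).ascFactorial (2 * r) = Nat.factorial (x + y + e + 2 * r) :=
    Nat.factorial_mul_ascFactorial _ _
  have hzr : Nat.factorial (z + r) = Nat.factorial (r + z) := by rw [Nat.add_comm]
  calc (x + e).choose e * (y + e').choose e' * (y + e' + 1).ascFactorial r * (x + y + e + 2 * r).choose (r + z) *
        (z + 1).ascFactorial r * (Nat.factorial x * Nat.factorial e * Nat.factorial y * Nat.factorial e' *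
        Nat.factorial z)
      = ((x + e).choose e * Nat.factorial e * Nat.factorial x) *
          (((y + e').choose e' * Nat.factorial e' * Nat.factorial y) * (y + e' + 1).ascFactorial r) *
          (x + y + e + 2 * r).choose (r + z) * (Nat.factorial z * (z + 1).ascFactorial r) := by ring
    _ = Nat.factorial (x + e) * ((x + y + e + 2 * r).choose (r + z) * Nat.factorial (r + z) *
          Nat.factorial (y + e' + r)) := by rw [c1, c2, c5, c3, hzr]; ring
    _ = Nat.factorial (x + e) * Nat.factorial (x + y + e + 2 * r) := by rw [c4]
    _ = ((x + y + e).choose (y + e) * ((y + e).choose e * Nat.factorial e * Nat.factorial y) * Nat.factorial x) *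
          ((x + e).choose e' * Nat.factorial e' * Nat.factorial z) * (x + y + e + 1).ascFactorial (2 * r) := by
        rw [c6, c8, c7, ← c9]; ring
    _ = (x + y + e).choose (y + e) * (y + e).choose e * (x + e).choose e' * (x + y + e + 1).ascFactorial (2 * r) *
          (Nat.factorial x * Nat.factorial e * Nat.factorial y * Nat.factorial e' * Nat.factorial z) := by ring

/-- The remaining factor identity of the second tale, by induction on `d = N − r` (the common term ratio is
`−(y+e'+2r−N)`): `C(x+e,e) (−1)^r C(y+e',e') (y+e'+1)_r C(x+y+e+2r, r+d+z) (z+1)_{r+d} (−1)^{r+d}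
= K (x+y+e+1)_{2r} (−(y+e'+r))_d`. -/
theorem f4 (x y z e e' r d : ℕ) (hz : x + e = z + e') :
    (((x + e).choose e : ℕ) : ℤ) * (-1) ^ r * (((y + e').choose e' : ℕ) : ℤ) * rf ((((y + e') : ℕ) : ℤ) + 1) r *
        (((x + y + e + 2 * r).choose (r + d + z) : ℕ) : ℤ) * rf ((z : ℤ) + 1) (r + d) * (-1) ^ (r + d) =
      ((((x + y + e).choose (y + e) : ℕ) : ℤ) * (((y + e).choose e : ℕ) : ℤ) * (((x + e).choose e' : ℕ) : ℤ)) *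
        rf ((((x + y + e) : ℕ) : ℤ) + 1) (2 * r) * rf (-((((y + e' + r) : ℕ)) : ℤ)) d := by
  induction d with
  | zero =>
    have hb := congrArg (Nat.cast (R := ℤ)) (f4base x y z e e' r hz)
    push_cast at hb
    have hs : (-1 : ℤ) ^ r * (-1) ^ r = 1 := by rw [← mul_pow]; simp
    simp only [rf_natCast_succ, Nat.add_zero, rf_zero, mul_one]
    linear_combination hb + ((((x + e).choose e : ℕ) : ℤ) * (((y + e').choose e' : ℕ) : ℤ) *
      (((y + e' + 1).ascFactorial r : ℕ) : ℤ) * (((x + y + e + 2 * r).choose (r + z) : ℕ) : ℤ) *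
      (((z + 1).ascFactorial r : ℕ) : ℤ)) * hs
  | succ d ih =>
    rcases Nat.lt_or_ge (y + e' + r) (d + 1) with hlt | hge
    · -- both sides vanish
      have hc : (x + y + e + 2 * r).choose (r + (d + 1) + z) = 0 :=
        Nat.choose_eq_zero_of_lt (by omega)
      rw [rf_neg_natCast_eq_zero hlt, hc]
      simp
    · -- ratio step; cancel the positive integer `r + d + z + 1`
      have hq : (((x + y + e + 2 * r).choose (r + d + z + 1) : ℕ) : ℤ) * ((r : ℤ) + d + z + 1) =
          (((x + y + e + 2 * r).choose (r + d + z) : ℕ) : ℤ) * ((y : ℤ) + e' + r - d) := by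
        have h := Nat.choose_succ_right_eq (x + y + e + 2 * r) (r + d + z)
        have h' := congrArg (Nat.cast (R := ℤ)) h
        push_cast [Nat.cast_sub (show r + d + z ≤ x + y + e + 2 * r by omega)] at h'
        have hz' : ((x : ℤ) + e) = z + e' := by exact_mod_cast hz
        linear_combination h' + (((x + y + e + 2 * r).choose (r + d + z) : ℕ) : ℤ) * hz'
      have hpos : ((r : ℤ) + d + z + 1) ≠ 0 := by positivity
      apply mul_right_cancel₀ hpos
      rw [show r + (d + 1) + z = r + d + z + 1 by ring, show r + (d + 1) = r + d + 1 by ring, rf_succ, rf_succ,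
        pow_succ]
      push_cast at ih hq ⊢
      linear_combination ((((x + e).choose e : ℕ) : ℤ) * (-1) ^ r * (((y + e').choose e' : ℕ) : ℤ) *
          rf ((y : ℤ) + e' + 1) r * rf ((z : ℤ) + 1) (r + d) * (-1) ^ (r + d) * (-1) *
          ((z : ℤ) + 1 + (r + d))) * hq +
        (-((y : ℤ) + e' + r - d) * ((r : ℤ) + d + z + 1)) * ih

/-- **Termwise dictionary, second tale**: `U_r · (x+1)_N (y+1)_N (z+1)_N · (−1)^N = K · saalschutzianTerm
(x+y+e+1) (x+1) (−e) (z+1) N r`. -/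
theorem dictU (x y z e e' N r : ℕ) (hz : x + e = z + e') (hr : r ≤ N) :
    ((((x + y + e + 2 * r).choose (N + z) : ℕ) : ℤ) * (((r + (y + e')).choose e' : ℕ) : ℤ) *
        (((x + e).choose (x + r) : ℕ) : ℤ) * ((N.choose r : ℕ) : ℤ)) *
      (rf ((x : ℤ) + 1) N * rf ((y : ℤ) + 1) N * rf ((z : ℤ) + 1) N) * (-1) ^ N =
    ((((x + y + e).choose (y + e) : ℕ) : ℤ) * (((y + e).choose e : ℕ) : ℤ) * (((x + e).choose e' : ℕ) : ℤ)) *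
      saalschutzianTerm ((x : ℤ) + y + e + 1) ((x : ℤ) + 1) (-(e : ℤ)) ((z : ℤ) + 1) N r := by
  have hA := choose_mul_rf_neg x e r
  have hB := choose_mul_rf (y + e') e' r (by omega)
  rw [show ((y + e' : ℕ) : ℤ) + 1 - ((e' : ℕ) : ℤ) = (y : ℤ) + 1 by push_cast; ring,
    show ((y + e' : ℕ) : ℤ) + 1 = (y : ℤ) + e' + 1 by push_cast; ring] at hB
  have hF := f4 x y z e e' r (N - r) hz
  rw [show r + (N - r) + z = N + z by omega, show r + (N - r) = N by omega] at hF
  push_cast at hF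
  have hz' : ((x : ℤ) + e) = z + e' := by exact_mod_cast hz
  have t1 : rf ((x : ℤ) + 1) N = rf ((x : ℤ) + 1) r * rf ((x : ℤ) + 1 + r) (N - r) := by
    rw [← rf_add, Nat.add_sub_cancel' hr]
  have t2 : rf ((y : ℤ) + 1) N = rf ((y : ℤ) + 1) r * rf ((y : ℤ) + 1 + r) (N - r) := by
    rw [← rf_add, Nat.add_sub_cancel' hr]
  unfold saalschutzianTerm
  rw [show ((z : ℤ) + 1 - ((x : ℤ) + y + e + 1) - r) = -((y : ℤ) + e' + r) by linarith,
    show (1 + ((x : ℤ) + y + e + 1) + -(e : ℤ) - ((x : ℤ) + 1) + r) = (y : ℤ) + 1 + r by ring, t1, t2]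
  linear_combination
    (((N.choose r : ℕ) : ℤ) * rf ((x : ℤ) + 1 + r) (N - r) * rf ((y : ℤ) + 1 + r) (N - r) *
        ((((r + (y + e')).choose e' : ℕ) : ℤ) * rf ((y : ℤ) + 1) r) *
        ((((x + y + e + 2 * r).choose (N + z) : ℕ) : ℤ) * rf ((z : ℤ) + 1) N * (-1) ^ N)) * hA +
    (((N.choose r : ℕ) : ℤ) * rf ((x : ℤ) + 1 + r) (N - r) * rf ((y : ℤ) + 1 + r) (N - r) *
        ((((x + e).choose e : ℕ) : ℤ) * ((-1) ^ r * rf (-(e : ℤ)) r)) *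
        ((((x + y + e + 2 * r).choose (N + z) : ℕ) : ℤ) * rf ((z : ℤ) + 1) N * (-1) ^ N)) * hB +
    (((N.choose r : ℕ) : ℤ) * rf ((x : ℤ) + 1 + r) (N - r) * rf ((y : ℤ) + 1 + r) (N - r) * rf (-(e : ℤ)) r) * hF

/-! ### Remark 5 in binomial form -/

/-- Abstract cancellation step: termwise dictionaries on both sides of a transformation `∑ np = ∑ sa` with a
common nonzero normaliser `Pr` give `∑ U = (−1)^N ∑ T`. -/
theorem sum_eq_of_dictionary (N : ℕ) {U T sa np : ℕ → ℤ} {Pr K : ℤ} (hPr : Pr ≠ 0)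
    (hU : ∀ r ≤ N, U r * Pr * (-1) ^ N = K * sa r) (hT : ∀ n ≤ N, T n * Pr = K * np n)
    (hW : ∑ n ∈ range (N + 1), np n = ∑ r ∈ range (N + 1), sa r) :
    ∑ r ∈ range (N + 1), U r = (-1) ^ N * ∑ n ∈ range (N + 1), T n := by
  have key : (∑ r ∈ range (N + 1), U r) * Pr * (-1) ^ N = Pr * ∑ n ∈ range (N + 1), T n := by
    calc (∑ r ∈ range (N + 1), U r) * Pr * (-1) ^ N = ∑ r ∈ range (N + 1), U r * Pr * (-1) ^ N := by
          rw [Finset.sum_mul, Finset.sum_mul]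
      _ = ∑ r ∈ range (N + 1), K * sa r :=
          Finset.sum_congr rfl fun r hr => hU r (by have := mem_range.mp hr; omega)
      _ = K * ∑ n ∈ range (N + 1), np n := by rw [← Finset.mul_sum, hW]
      _ = ∑ n ∈ range (N + 1), T n * Pr := by
          rw [Finset.mul_sum]
          exact Finset.sum_congr rfl fun n hn => (hT n (by have := mem_range.mp hn; omega)).symm
      _ = Pr * ∑ n ∈ range (N + 1), T n := by
          rw [Finset.mul_sum]
          exact Finset.sum_congr rfl fun n _ => mul_comm _ _
  have hs : ((-1 : ℤ) ^ N) * (-1) ^ N = 1 := by rw [← mul_pow]; simp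
  apply mul_right_cancel₀ hPr
  calc (∑ r ∈ range (N + 1), U r) * Pr = (∑ r ∈ range (N + 1), U r) * Pr * ((-1) ^ N * (-1) ^ N) := by
        rw [hs, mul_one]
    _ = ((∑ r ∈ range (N + 1), U r) * Pr * (-1) ^ N) * (-1) ^ N := by ring
    _ = (Pr * ∑ n ∈ range (N + 1), T n) * (-1) ^ N := by rw [key]
    _ = (-1) ^ N * (∑ n ∈ range (N + 1), T n) * Pr := by ring

/-- **Zudilin's Remark 5 in binomial form** (the regime `a₁, a₂, a₃ ≤ a₄`; `x = a₄−a₁`, `y = a₄−a₂`,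
`z = a₄−a₃`, `e = a₁+a₂−a₄−1`, `e' = a₂+a₃−a₄−1`, `N = b₄−a₄−1`, so `x + e = z + e'`):
`∑_{r≤N} C(x+y+e+2r, N+z) C(r+y+e', e') C(x+e, x+r) C(N, r)
 = (−1)^N ∑_{n≤N} (−1)^n C(N,n) C(n+x+y+e, y+e) C(n+y+e, e) C(n+x+e, e')`
— from Whipple's transformation `whipple_nearlyPoised_terms` at `f = x+y+e+1, h = x+1, a = −e, g = z+1` via
`dictT`, `dictU` and cancellation of `(x+1)_N (y+1)_N (z+1)_N > 0`. [cite: Zudilin2014ZetaTwo, Remark 5;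
Slater1966, (2.4.2.3)] -/
theorem binomialWhipple (x y z e e' N : ℕ) (hz : x + e = z + e') :
    ∑ r ∈ range (N + 1), (((x + y + e + 2 * r).choose (N + z) : ℕ) : ℤ) * (((r + (y + e')).choose e' : ℕ) : ℤ) *
        (((x + e).choose (x + r) : ℕ) : ℤ) * ((N.choose r : ℕ) : ℤ) =
      (-1) ^ N * ∑ n ∈ range (N + 1), (-1 : ℤ) ^ n * ((N.choose n : ℕ) : ℤ) *
        (((n + (x + y + e)).choose (y + e) : ℕ) : ℤ) * (((n + (y + e)).choose e : ℕ) : ℤ) *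
        (((n + (x + e)).choose e' : ℕ) : ℤ) := by
  have hPr : rf ((x : ℤ) + 1) N * rf ((y : ℤ) + 1) N * rf ((z : ℤ) + 1) N ≠ 0 :=
    (mul_pos (mul_pos (rf_natCast_succ_pos x N) (rf_natCast_succ_pos y N)) (rf_natCast_succ_pos z N)).ne'
  exact sum_eq_of_dictionary N hPr (fun r hr => dictU x y z e e' N r hz hr) (fun n hn => dictT x y z e e' N n hz hn)
    (whipple_nearlyPoised_terms _ _ _ _ N)

end Summit.KontsevichZagierPeriods.Zeta5Search.TwoTaleWhippleBinomial
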